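import Summits.Ventures.PercRepro.S1CoreCapSevenCases
import Summits.Ventures.PercRepro.S1CoreCapSevenTwoNon

/-!
# PercRepro — `Q*(7) = 19` MODULO ONE OPEN CASE (p1, gen 26)

The open case B of S1CoreCapSevenCases is discharged by S1CoreCapSevenTwoNon (`twoBigNoncoplanarBound_holds`),
so `FourCapSpec capPaper 7 19` now follows from the single proposition `ThreeBigNonplanarBound` — three lines of
`≥ 4` points not in a plane (`fourCapSpec_seven_of_threeBig`). `proofs/P1-S4-CAPBRIDGE.md` §18.
Axioms: standard.
-/

namespace PercRepro

namespace S1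

namespace FourCap

namespace Seven

/-- **Open case B holds**: two big lines in no plane give cap sum `≤ 19`. -/
theorem twoBigNoncoplanarBound_holds : TwoBigNoncoplanarBound := by
  intro β _ w ls h1 h2 h3 h4 _ _ L₁ L₂ hL₁ hL₂ h12 c1 c2 hrest hnc
  exact sum_cap_le_nineteen_of_two_big_noncoplanar h1 h2 h3 h4 hL₁ hL₂ h12 c1 c2 hrest hnc

/-- **THE INSTANCE `ν = 7` MODULO ONE OPEN CASE**: `FourCapSpec capPaper 7 19` follows from
`ThreeBigNonplanarBound` alone. -/
theorem fourCapSpec_seven_of_threeBig (hA : ThreeBigNonplanarBound) : FourCapSpec capPaper 7 19 :=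
  fourCapSpec_seven_of hA twoBigNoncoplanarBound_holds

end Seven

end FourCap

end S1

end PercRepro
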